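import Literature.Probability.LatticeModels.PlaneRotatorFreeTwoPoint
import Literature.Probability.LatticeModels.LayeredPlaneRotatorExplicitWindow
import HarnessLib

/-!
# Weakly coupled XY layers: the finite-susceptibility phase of the stack versus that of one layer —
# `χ^{3D}(β; J∥, J⊥) < ∞ ⇒ χ^{2D}(βJ∥) < ∞` for EVERY `J⊥`, and `χ^{2D}(K₀) < ∞ ⇒ χ^{3D} < ∞` for `βJ∥ ≤ K₀`,
# `βJ⊥ ≤ δ(K₀)`

Topic `Literature/Probability/LatticeModels`. The classical LAYERED plane rotator (`layeredXYCoupling β J∥ J⊥ Λ` of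
`PlaneRotatorMeanFieldBound.lean`: `J∥ ≥ 0` on in-plane nearest-neighbour bonds of `ℤ³`, `J⊥ ≥ 0` on the vertical
ones, free boundary conditions) is the comparison model of the 2D → 3D ("interlayer", `E(Δ)`) device of cell
`pub/hubbard-tc` (MO-S3; keys K4-c/K5, INTERLAYER L3). This file defines its **infinite-volume two-point function**
`G^{3D}(x, y) = sup_n ⟨cos(θ_x − θ_y)⟩_{[−n,n]³}` (`infTwoPointLayered`, Griffiths–Ginibre monotone limit along boxes,
exactly as the single-layer object `infTwoPoint` of `PlaneRotatorFreeTwoPoint.lean`) and compares the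
finite-susceptibility ("high-temperature") phases of the stack and of ONE layer in BOTH directions:

* §1–§2 `volTwoPointLayered`, `infTwoPointLayered`, monotonicity in the volume (`volTwoPointLayered_mono`), the
  limit along boxes (`tendsto_volTwoPointLayered_box`), domination of every finite volume, and
  **Griffiths–Ginibre monotonicity in the couplings** (`infTwoPointLayered_mono_of_mul_le`).
* §3 **A layer sits below the stack** (`infTwoPoint_le_infTwoPointLayered`): for `x, y ∈ ℤ²` embedded in the layer
  `ℓ = 0`, `G^{2D}_{βJ∥}(x, y) ≤ G^{3D}_{β; J∥, J⊥}(ιx, ιy)` (the vertical bonds are additional ferromagnetic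
  couplings; J. Ginibre, Comm. Math. Phys. **16** (1970) 310 [Ginibre1970]). Hence
  **`summable_layer_of_summable_layered`**: `∑_{z ∈ ℤ³} G^{3D}(0, z) < ∞ ⇒ ∑_{x ∈ ℤ²} G^{2D}_{βJ∥}(0, x) < ∞`, and
  with the Simon–Lieb dichotomy of `PlaneRotatorFreeTwoPoint.lean`: the single layer's finite algorithm terminates
  (`exists_nnBoxShellSum_lt_one_of_summable_layered`) and its torus helicity modulus vanishes
  (`tendsto_torusXYStiffness_of_summable_layered`). READ: **interlayer coupling cannot lower the transition — for
  EVERY `J⊥ ≥ 0` the finite-susceptibility phase of the stack lies inside that of one layer,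
  `T_χ^{3D}(J∥, J⊥) ≥ T_χ^{2D}(J∥)`** (the rigorous `E(Δ) ≥ 1` in susceptibility currency).
* §4 **Simon's lattice sum in every dimension** (`summable_pow_supNorm_div`): `∑_{x ∈ ℤ^ν} m^{⌊‖x‖_∞/R⌋} < ∞` for
  `0 ≤ m < 1`, `R ≥ 1` (B. Simon, Comm. Math. Phys. **77** (1980) 111 [Simon1980CMP], Thm 1.3: exponential decay
  summed over the lattice; the tree had the closed form `X_R` for `ν = 2` only).
* §5 **The converse at weak coupling** (`summable_layered_of_nnBoxShellSum_lt_one`,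
  `summable_layered_of_summable_layer`): if ONE two-dimensional box terminates, `S_R(K₀) < 1` — equivalently
  (`summable_infTwoPoint_iff`) if `χ^{2D}(K₀) < ∞` — then with the EXPLICIT threshold
  `δ = (1 − S_R(K₀))/(2(χ^{int}_R(K₀) + 1))` of `LayeredPlaneRotatorExplicitWindow.lean`, for all `β, J∥, J⊥ ≥ 0`
  with `βJ∥ ≤ K₀`, `βJ⊥ ≤ δ`: `G^{3D} ≤ ((1 + S_R)/2)^{⌊‖x − y‖_∞/R⌋}` and `∑_{z ∈ ℤ³} G^{3D}(0, z) < ∞`. READ: **weak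
  interlayer coupling cannot raise the transition by much — every `K₀` of the single layer's finite-susceptibility
  phase stays in the stack's for `βJ⊥ ≤ δ(K₀)`: `lim_{J⊥ → 0} T_χ^{3D}(J∥, J⊥) = T_χ^{2D}(J∥)`** (the rigorous
  `E(Δ) → 1`), with `T_χ^{2D}` the TRUE single-layer susceptibility temperature (bounded above by
  `J∥/log(1+√2) = 1.1346·J∥`, `summable_layered_of_lt_log_one_add_sqrt_two`).

* `summable_infTwoPoint_of_le`, `summable_layered_of_mul_le` (both phases are down-sets in the couplings — Griffiths–Ginibre) and the summary
  **`summable_layer_iff_summable_layered_weak`**: `χ^{2D}(K₀) < ∞ ⇔ ∃ δ > 0, χ^{3D} < ∞ whenever βJ∥ ≤ K₀, βJ⊥ ≤ δ` —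
  the single layer's finite-susceptibility phase is EXACTLY the weak-coupling limit of the stack's.

All PROVED, no numerics; cell reading number-neutral. WHAT THIS IS NOT: `T_χ` is the divergence of the free
susceptibility, not the Kosterlitz–Thouless temperature of the layer (no Fröhlich–Spencer input: `T_χ^{2D} ≥ T_KT` is
not claimed); classical comparison model only, never a Hubbard or material statement.
-/

noncomputable section

open MeasureTheory Finset Filter Topology
open scoped BigOperators

namespace Literature.Probability.LatticeModels

namespace PlaneRotator

open Literature.Barriers.CriticalPhenomena Literature.Barriers.CriticalPhenomena.LongRangeIsing

variable [MeasurableSpace Circle] [BorelSpace Circle]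

/-! ## §1 Finite-volume two-point functions of the layered model between lattice sites -/

section Volume

/-- The **finite-volume two-point function of the layered XY model between lattice sites of `ℤ³`**:
`⟨cos(θ_x − θ_y)⟩_{Λ; β, J∥, J⊥}` (free boundary conditions on the finite `Λ`) if `x, y ∈ Λ`, `0` otherwise.
[cite: Ginibre1970, Example 4 (plane rotators); LiuStanley1972, p. 272 (layers (J, J, εJ))] -/
def volTwoPointLayered (β Jp Jz : ℝ) (Λ : Finset (Site 3)) (x y : Site 3) : ℝ :=
  if h : x ∈ Λ ∧ y ∈ Λ then twoPoint (layeredXYCoupling β Jp Jz Λ) ⟨x, h.1⟩ ⟨y, h.2⟩ else 0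

/-- Inside the volume, `volTwoPointLayered` is the two-point function. [cite: Ginibre1970, Example 4 (plane rotators)] -/
theorem volTwoPointLayered_of_mem (β Jp Jz : ℝ) {Λ : Finset (Site 3)} {x y : Site 3} (hx : x ∈ Λ) (hy : y ∈ Λ) :
    volTwoPointLayered β Jp Jz Λ x y = twoPoint (layeredXYCoupling β Jp Jz Λ) ⟨x, hx⟩ ⟨y, hy⟩ := by
  unfold volTwoPointLayered
  rw [dif_pos ⟨hx, hy⟩]

/-- `0 ≤ volTwoPointLayered` for `β, J∥, J⊥ ≥ 0`. [cite: Ginibre1970, Example 4 (plane rotators)] -/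
theorem volTwoPointLayered_nonneg {β Jp Jz : ℝ} (hβ : 0 ≤ β) (hp : 0 ≤ Jp) (hz : 0 ≤ Jz) (Λ : Finset (Site 3))
    (x y : Site 3) : 0 ≤ volTwoPointLayered β Jp Jz Λ x y := by
  unfold volTwoPointLayered
  split_ifs with h
  · exact twoPoint_nonneg (layeredXYCoupling_nonneg hβ hp hz Λ) _ _
  · exact le_rfl

/-- `volTwoPointLayered ≤ 1`. [cite: Ginibre1970, Example 4 (plane rotators)] -/
theorem volTwoPointLayered_le_one (β Jp Jz : ℝ) (Λ : Finset (Site 3)) (x y : Site 3) :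
    volTwoPointLayered β Jp Jz Λ x y ≤ 1 := by
  unfold volTwoPointLayered
  split_ifs with h
  · exact twoPoint_le_one _ _ _
  · exact zero_le_one

/-- **Griffiths–Ginibre monotonicity in the volume** for the layered model: `Λ ⊆ Λ'` ⇒
`⟨cos(θ_x − θ_y)⟩_Λ ≤ ⟨cos(θ_x − θ_y)⟩_{Λ'}` (`β, J∥, J⊥ ≥ 0`). [cite: Ginibre1970, Prop. 3 with Example 4 (plane rotators)] -/
theorem volTwoPointLayered_mono {β Jp Jz : ℝ} (hβ : 0 ≤ β) (hp : 0 ≤ Jp) (hz : 0 ≤ Jz) {Λ Λ' : Finset (Site 3)}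
    (hΛ : Λ ⊆ Λ') (x y : Site 3) : volTwoPointLayered β Jp Jz Λ x y ≤ volTwoPointLayered β Jp Jz Λ' x y := by
  classical
  by_cases h : x ∈ Λ ∧ y ∈ Λ
  · rw [volTwoPointLayered_of_mem β Jp Jz h.1 h.2, volTwoPointLayered_of_mem β Jp Jz (hΛ h.1) (hΛ h.2)]
    let τ : Λ → Λ' := fun u => ⟨(u : Site 3), hΛ u.2⟩
    have hτ : Set.InjOn τ (Finset.univ : Finset Λ) := fun u _ v _ huv => by
      have h' : ((τ u : Λ') : Site 3) = (τ v : Λ') := congrArg Subtype.val huv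
      exact Subtype.ext h'
    exact twoPoint_le_of_injOn (layeredXYCoupling_nonneg hβ hp hz Λ) (A := Finset.univ)
      (fun p _ => ⟨Finset.mem_univ _, Finset.mem_univ _⟩) τ hτ (layeredXYCoupling_nonneg hβ hp hz Λ')
      (fun u _ v _ => le_rfl) (Finset.mem_univ _) (Finset.mem_univ _)
  · unfold volTwoPointLayered
    rw [dif_neg h]
    exact volTwoPointLayered_nonneg hβ hp hz Λ' x y

/-- **Griffiths–Ginibre monotonicity in the couplings**, finite volume: `βJ∥ ≤ K∥`, `βJ⊥ ≤ K⊥` ⇒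
`⟨cos(θ_x − θ_y)⟩_{Λ; β, J∥, J⊥} ≤ ⟨cos(θ_x − θ_y)⟩_{Λ; 1, K∥, K⊥}` (tree `twoPoint_layered_mono_of_mul_le`).
[cite: Ginibre1970, Prop. 3 with Example 4 (plane rotators)] -/
theorem volTwoPointLayered_mono_of_mul_le {β Jp Jz Kp Kz : ℝ} (hβ : 0 ≤ β) (hp : 0 ≤ Jp) (hz : 0 ≤ Jz)
    (hKp : β * Jp ≤ Kp) (hKz : β * Jz ≤ Kz) (Λ : Finset (Site 3)) (x y : Site 3) :
    volTwoPointLayered β Jp Jz Λ x y ≤ volTwoPointLayered 1 Kp Kz Λ x y := by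
  unfold volTwoPointLayered
  split_ifs with h
  · exact twoPoint_layered_mono_of_mul_le hβ hp hz hKp hKz Λ _ _
  · exact le_rfl

omit [MeasurableSpace Circle] [BorelSpace Circle] in
/-- Every finite set of sites of `ℤ³` lies in a box. [folklore] -/
private theorem exists_subset_box₃ (Λ : Finset (Site 3)) : ∃ n : ℕ, Λ ⊆ box 3 n := by
  classical
  refine ⟨Λ.sup Site.supNorm, fun x hx => mem_box_iff_supNorm_le.2 ?_⟩
  exact Finset.le_sup (f := Site.supNorm) hx

end Volume

/-! ## §2 The infinite-volume two-point function of the stack -/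

section Infinite

/-- The **infinite-volume (free-state) two-point function of the layered XY model on `ℤ³`**:
`G^{3D}_{β; J∥, J⊥}(x, y) = sup_n ⟨cos(θ_x − θ_y)⟩_{[−n,n]³; β, J∥, J⊥}` (Griffiths–Ginibre monotone limit along boxes).
[cite: Ginibre1970, Prop. 3 with Example 4 (plane rotators); LiuStanley1972, p. 272 (layers (J, J, εJ))] -/
def infTwoPointLayered (β Jp Jz : ℝ) (x y : Site 3) : ℝ := ⨆ n : ℕ, volTwoPointLayered β Jp Jz (box 3 n) x y

/-- The box two-point functions are bounded by `1`, so the supremum is a genuine one.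
[cite: Ginibre1970, Example 4 (plane rotators)] -/
theorem bddAbove_volTwoPointLayered_box (β Jp Jz : ℝ) (x y : Site 3) :
    BddAbove (Set.range fun n : ℕ => volTwoPointLayered β Jp Jz (box 3 n) x y) :=
  ⟨1, by rintro _ ⟨n, rfl⟩; exact volTwoPointLayered_le_one β Jp Jz _ x y⟩

/-- Every box is dominated by the infinite volume. [cite: Ginibre1970, Prop. 3 with Example 4 (plane rotators)] -/
theorem volTwoPointLayered_box_le_inf (β Jp Jz : ℝ) (n : ℕ) (x y : Site 3) :
    volTwoPointLayered β Jp Jz (box 3 n) x y ≤ infTwoPointLayered β Jp Jz x y :=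
  le_ciSup (bddAbove_volTwoPointLayered_box β Jp Jz x y) n

/-- **Every finite volume is dominated by the infinite-volume two-point function** (`β, J∥, J⊥ ≥ 0`).
[cite: Ginibre1970, Prop. 3 with Example 4 (plane rotators)] -/
theorem volTwoPointLayered_le_inf {β Jp Jz : ℝ} (hβ : 0 ≤ β) (hp : 0 ≤ Jp) (hz : 0 ≤ Jz) (Λ : Finset (Site 3))
    (x y : Site 3) : volTwoPointLayered β Jp Jz Λ x y ≤ infTwoPointLayered β Jp Jz x y := by
  obtain ⟨n, hn⟩ := exists_subset_box₃ Λ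
  exact (volTwoPointLayered_mono hβ hp hz hn x y).trans (volTwoPointLayered_box_le_inf β Jp Jz n x y)

/-- Subtype form: the two-point function inside `Λ` is dominated by the infinite volume.
[cite: Ginibre1970, Prop. 3 with Example 4 (plane rotators)] -/
theorem twoPoint_layered_le_inf {β Jp Jz : ℝ} (hβ : 0 ≤ β) (hp : 0 ≤ Jp) (hz : 0 ≤ Jz) (Λ : Finset (Site 3))
    (a c : Λ) : twoPoint (layeredXYCoupling β Jp Jz Λ) a c ≤ infTwoPointLayered β Jp Jz (a : Site 3) (c : Site 3) := by
  have h := volTwoPointLayered_le_inf hβ hp hz Λ (a : Site 3) (c : Site 3)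
  rwa [volTwoPointLayered_of_mem β Jp Jz a.2 c.2] at h

/-- `G^{3D} ≤ 1`. [cite: Ginibre1970, Example 4 (plane rotators)] -/
theorem infTwoPointLayered_le_one (β Jp Jz : ℝ) (x y : Site 3) : infTwoPointLayered β Jp Jz x y ≤ 1 :=
  ciSup_le fun _ => volTwoPointLayered_le_one β Jp Jz _ x y

/-- `0 ≤ G^{3D}` for `β, J∥, J⊥ ≥ 0`. [cite: Ginibre1970, Example 4 (plane rotators)] -/
theorem infTwoPointLayered_nonneg {β Jp Jz : ℝ} (hβ : 0 ≤ β) (hp : 0 ≤ Jp) (hz : 0 ≤ Jz) (x y : Site 3) :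
    0 ≤ infTwoPointLayered β Jp Jz x y :=
  (volTwoPointLayered_nonneg hβ hp hz (box 3 0) x y).trans (volTwoPointLayered_box_le_inf β Jp Jz 0 x y)

/-- An upper bound valid in every box is an upper bound for `G^{3D}` (the infinite-volume state is the limit of the
box states). [cite: Simon1980CMP, Thm 1.3 (infinite-volume two-point function as the limit of finite volumes)] -/
theorem infTwoPointLayered_le_of_forall_box {β Jp Jz B : ℝ} {x y : Site 3}
    (h : ∀ n : ℕ, volTwoPointLayered β Jp Jz (box 3 n) x y ≤ B) : infTwoPointLayered β Jp Jz x y ≤ B :=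
  ciSup_le h

/-- **The thermodynamic limit along boxes exists and equals `G^{3D}`** (monotone convergence; `β, J∥, J⊥ ≥ 0`).
[cite: Ginibre1970, Prop. 3 with Example 4 (plane rotators); Simon1980CMP, Thm 1.3] -/
theorem tendsto_volTwoPointLayered_box {β Jp Jz : ℝ} (hβ : 0 ≤ β) (hp : 0 ≤ Jp) (hz : 0 ≤ Jz) (x y : Site 3) :
    Tendsto (fun n : ℕ => volTwoPointLayered β Jp Jz (box 3 n) x y) atTop (𝓝 (infTwoPointLayered β Jp Jz x y)) :=
  tendsto_atTop_ciSup (fun _ _ hnm => volTwoPointLayered_mono hβ hp hz (box_mono 3 hnm) x y)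
    (bddAbove_volTwoPointLayered_box β Jp Jz x y)

/-- **Griffiths–Ginibre monotonicity of `G^{3D}` in the couplings**: `βJ∥ ≤ K∥`, `βJ⊥ ≤ K⊥` ⇒
`G^{3D}_{β; J∥, J⊥} ≤ G^{3D}_{1; K∥, K⊥}` — in particular the finite-susceptibility phase is inherited downwards in
both couplings. [cite: Ginibre1970, Prop. 3 with Example 4 (plane rotators)] -/
theorem infTwoPointLayered_mono_of_mul_le {β Jp Jz Kp Kz : ℝ} (hβ : 0 ≤ β) (hp : 0 ≤ Jp) (hz : 0 ≤ Jz)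
    (hKp : β * Jp ≤ Kp) (hKz : β * Jz ≤ Kz) (x y : Site 3) :
    infTwoPointLayered β Jp Jz x y ≤ infTwoPointLayered 1 Kp Kz x y :=
  ciSup_le fun n => (volTwoPointLayered_mono_of_mul_le hβ hp hz hKp hKz (box 3 n) x y).trans
    (volTwoPointLayered_box_le_inf 1 Kp Kz n x y)

end Infinite

/-! ## §3 A layer sits below the stack: `G^{2D}_{βJ∥} ≤ G^{3D}` on the layer `ℓ = 0` -/

section Layer

/-- The embedding of `ℤ²` as the layer `ℓ = 0` of `ℤ³`. [cite: LiuStanley1972, p. 272 (layers (J, J, εJ))] -/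
def layerEmbed (x : Site 2) : Site 3 := ![x 0, x 1, 0]

omit [MeasurableSpace Circle] [BorelSpace Circle] in
/-- Coordinates of the layer embedding. [folklore] -/
private theorem layerEmbed_apply (x : Site 2) :
    layerEmbed x 0 = x 0 ∧ layerEmbed x 1 = x 1 ∧ layerEmbed x 2 = 0 := by
  simp [layerEmbed]

omit [MeasurableSpace Circle] [BorelSpace Circle] in
/-- The layer embedding is additive: `ι(x − y) = ιx − ιy`. [folklore] -/
private theorem layerEmbed_sub (x y : Site 2) : layerEmbed (x - y) = layerEmbed x - layerEmbed y := by
  funext i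
  fin_cases i <;> simp [layerEmbed]

omit [MeasurableSpace Circle] [BorelSpace Circle] in
/-- `ι 0 = 0`. [folklore] -/
private theorem layerEmbed_zero : layerEmbed (0 : Site 2) = 0 := by
  funext i
  fin_cases i <;> simp [layerEmbed]

omit [MeasurableSpace Circle] [BorelSpace Circle] in
/-- The layer embedding is injective. [folklore] -/
private theorem layerEmbed_injective : Function.Injective layerEmbed := by
  intro x y h
  funext i
  fin_cases i
  · simpa [layerEmbed] using congrFun h 0
  · simpa [layerEmbed] using congrFun h 1

omit [MeasurableSpace Circle] [BorelSpace Circle] in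
/-- The layer embedding preserves the `ℓ¹` norm. [folklore] -/
private theorem l1Norm_layerEmbed (x : Site 2) : l1Norm (layerEmbed x) = l1Norm x := by
  simp [l1Norm, layerEmbed, Fin.sum_univ_three, Fin.sum_univ_two]

omit [MeasurableSpace Circle] [BorelSpace Circle] in
/-- The layer embedding preserves the sup norm. [folklore] -/
private theorem supNorm_layerEmbed (x : Site 2) : Site.supNorm (layerEmbed x) = Site.supNorm x := by
  apply le_antisymm
  · refine Site.supNorm_le_iff.2 fun i => ?_
    fin_cases i
    · simpa [layerEmbed] using Site.natAbs_le_supNorm x 0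
    · simpa [layerEmbed] using Site.natAbs_le_supNorm x 1
    · simp [layerEmbed]
  · refine Site.supNorm_le_iff.2 fun i => ?_
    fin_cases i
    · simpa [layerEmbed] using Site.natAbs_le_supNorm (layerEmbed x) 0
    · simpa [layerEmbed] using Site.natAbs_le_supNorm (layerEmbed x) 1

omit [MeasurableSpace Circle] [BorelSpace Circle] in
/-- The layer embedding maps boxes into boxes. [folklore] -/
private theorem layerEmbed_mem_box {n : ℕ} {x : Site 2} (hx : x ∈ box 2 n) : layerEmbed x ∈ box 3 n := by
  rw [mem_box_iff_supNorm_le] at hx ⊢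
  rwa [supNorm_layerEmbed]

omit [MeasurableSpace Circle] [BorelSpace Circle] in
/-- On the embedded layer the layered coupling is the two-dimensional nearest-neighbour coupling at `K = βJ∥`.
[cite: LiuStanley1972, p. 272 (layers (J, J, εJ))] -/
private theorem layeredCoupling_layerEmbed (β Jp Jz : ℝ) (x y : Site 2) :
    β / 2 * layeredCoupling Jp Jz (layerEmbed x) (layerEmbed y) = β * Jp / 2 * nnCoupling 2 x y := by
  unfold layeredCoupling nnCoupling
  rw [← layerEmbed_sub, l1Norm_layerEmbed]
  have h2 : layerEmbed (x - y) 2 = 0 := (layerEmbed_apply (x - y)).2.2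
  rw [h2, if_pos (rfl : (0 : ℤ) = 0)]
  split_ifs <;> ring

/-- **A layer sits below the stack, box by box**: for `x, y ∈ ℤ²`,
`⟨cos(θ_x − θ_y)⟩_{[−n,n]², βJ∥} ≤ ⟨cos(θ_{ιx} − θ_{ιy})⟩_{[−n,n]³; β, J∥, J⊥}` — the two-dimensional model of the layer
`ℓ = 0` embeds into the stack, and the remaining (in-plane and vertical) bonds are additional ferromagnetic couplings
(Griffiths–Ginibre, `twoPoint_le_of_injOn`). [cite: Ginibre1970, Prop. 3 with Example 4 (plane rotators)] -/
theorem volTwoPoint_le_volTwoPointLayered_box {β Jp Jz : ℝ} (hβ : 0 ≤ β) (hp : 0 ≤ Jp) (hz : 0 ≤ Jz) (n : ℕ)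
    (x y : Site 2) :
    volTwoPoint (β * Jp) 2 (box 2 n) x y ≤ volTwoPointLayered β Jp Jz (box 3 n) (layerEmbed x) (layerEmbed y) := by
  classical
  by_cases h : x ∈ box 2 n ∧ y ∈ box 2 n
  · rw [volTwoPoint_of_mem (β * Jp) h.1 h.2,
      volTwoPointLayered_of_mem β Jp Jz (layerEmbed_mem_box h.1) (layerEmbed_mem_box h.2)]
    let τ : box 2 n → box 3 n := fun u => ⟨layerEmbed (u : Site 2), layerEmbed_mem_box u.2⟩
    have hτ : Set.InjOn τ (Finset.univ : Finset (box 2 n)) := fun u _ v _ huv => by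
      have h' : layerEmbed (u : Site 2) = layerEmbed (v : Site 2) := congrArg Subtype.val huv
      exact Subtype.ext (layerEmbed_injective h')
    have hK0 : ∀ p : box 2 n × box 2 n, 0 ≤ nnXYCoupling (β * Jp) 2 (box 2 n) p := fun p =>
      mul_nonneg (div_nonneg (mul_nonneg hβ hp) zero_le_two) (nnCoupling_nonneg _ _)
    refine twoPoint_le_of_injOn hK0 (A := Finset.univ) (fun p _ => ⟨Finset.mem_univ _, Finset.mem_univ _⟩) τ hτ
      (layeredXYCoupling_nonneg hβ hp hz (box 3 n)) (fun u _ v _ => le_of_eq ?_) (Finset.mem_univ _)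
      (Finset.mem_univ _)
    show nnXYCoupling (β * Jp) 2 (box 2 n) (u, v) = layeredXYCoupling β Jp Jz (box 3 n) (τ u, τ v)
    unfold nnXYCoupling layeredXYCoupling
    exact (layeredCoupling_layerEmbed β Jp Jz (u : Site 2) (v : Site 2)).symm
  · unfold volTwoPoint
    rw [dif_neg h]
    exact volTwoPointLayered_nonneg hβ hp hz _ _ _

/-- **A layer sits below the stack**: for every `J⊥ ≥ 0` and all `x, y ∈ ℤ²`,
`G^{2D}_{βJ∥}(x, y) ≤ G^{3D}_{β; J∥, J⊥}(ιx, ιy)`. [cite: Ginibre1970, Prop. 3 with Example 4 (plane rotators)] -/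
theorem infTwoPoint_le_infTwoPointLayered {β Jp Jz : ℝ} (hβ : 0 ≤ β) (hp : 0 ≤ Jp) (hz : 0 ≤ Jz) (x y : Site 2) :
    infTwoPoint (β * Jp) 2 x y ≤ infTwoPointLayered β Jp Jz (layerEmbed x) (layerEmbed y) :=
  infTwoPoint_le_of_forall_box fun n =>
    (volTwoPoint_le_volTwoPointLayered_box hβ hp hz n x y).trans (volTwoPointLayered_box_le_inf β Jp Jz n _ _)

/-- **Finite layered susceptibility forces a finite single-layer susceptibility**: if
`∑_{z ∈ ℤ³} G^{3D}_{β; J∥, J⊥}(0, z) < ∞` then `∑_{x ∈ ℤ²} G^{2D}_{βJ∥}(0, x) < ∞` — for EVERY interlayer coupling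
`J⊥ ≥ 0`. So the finite-susceptibility phase of the stack lies inside that of one layer:
`T_χ^{3D}(J∥, J⊥) ≥ T_χ^{2D}(J∥)` — interlayer coupling cannot lower the transition.
[cite: Ginibre1970, Prop. 3 with Example 4 (plane rotators); LiuStanley1972, p. 272 (T_c of the layers (J, J, εJ))] -/
theorem summable_layer_of_summable_layered {β Jp Jz : ℝ} (hβ : 0 ≤ β) (hp : 0 ≤ Jp) (hz : 0 ≤ Jz)
    (hG : Summable fun z : Site 3 => infTwoPointLayered β Jp Jz 0 z) :
    Summable fun x : Site 2 => infTwoPoint (β * Jp) 2 0 x := by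
  have hcomp : Summable fun x : Site 2 => infTwoPointLayered β Jp Jz 0 (layerEmbed x) :=
    hG.comp_injective layerEmbed_injective
  refine Summable.of_nonneg_of_le (fun x => infTwoPoint_nonneg (mul_nonneg hβ hp) 0 x) (fun x => ?_) hcomp
  have h := infTwoPoint_le_infTwoPointLayered hβ hp hz 0 x
  rwa [layerEmbed_zero] at h

/-- **The single layer's finite algorithm terminates wherever the stack has finite susceptibility**: if
`∑_z G^{3D}(0, z) < ∞` then `S_R(βJ∥) < 1` for some `R ≥ 1` (Simon–Lieb for the layer,
`exists_nnBoxShellSum_lt_one_of_summable`). [cite: Simon1980CMP, Thm 1.3; Lieb1980, p. 128 (boxes)] -/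
theorem exists_nnBoxShellSum_lt_one_of_summable_layered {β Jp Jz : ℝ} (hβ : 0 ≤ β) (hp : 0 ≤ Jp) (hz : 0 ≤ Jz)
    (hG : Summable fun z : Site 3 => infTwoPointLayered β Jp Jz 0 z) :
    ∃ R : ℕ, 1 ≤ R ∧ nnBoxShellSum (β * Jp) 2 R < 1 :=
  exists_nnBoxShellSum_lt_one_of_summable (mul_nonneg hβ hp) (summable_layer_of_summable_layered hβ hp hz hG)

/-- **The single layer's stiffness vanishes wherever the stack has finite susceptibility**: if
`∑_z G^{3D}_{β; J∥, J⊥}(0, z) < ∞` then the torus helicity modulus of ONE layer at `K = βJ∥` vanishes in the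
thermodynamic limit, `βΥ_{L}(βJ∥) → 0`. [cite: Simon1980CMP, Thm 1.3; Lieb1980, p. 128 (boxes)] -/
theorem tendsto_torusXYStiffness_of_summable_layered {β Jp Jz : ℝ} (hβ : 0 ≤ β) (hp : 0 ≤ Jp) (hz : 0 ≤ Jz)
    (hG : Summable fun z : Site 3 => infTwoPointLayered β Jp Jz 0 z) :
    Tendsto (fun L : ℕ => torusXYStiffness (L + 1) (β * Jp)) atTop (𝓝 0) :=
  tendsto_torusXYStiffness_of_summable_infTwoPoint (mul_nonneg hβ hp)
    (summable_layer_of_summable_layered hβ hp hz hG)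

end Layer

/-! ## §4 Simon's lattice sum in every dimension: `∑_{x ∈ ℤ^ν} m^{⌊‖x‖_∞/R⌋} < ∞` -/

section LatticeSum

variable {ν : ℕ}

omit [MeasurableSpace Circle] [BorelSpace Circle] in
/-- The sites with `⌊‖x‖_∞/R⌋ = k` lie in the box of radius `Rk + R − 1`. [folklore] -/
private theorem mem_box_of_supNorm_div_eq {R : ℕ} (hR : 1 ≤ R) {x : Site ν} {k : ℕ} (h : Site.supNorm x / R = k) :
    x ∈ box ν (R * k + (R - 1)) := by
  rw [mem_box_iff_supNorm_le]
  have h1 := Nat.lt_mul_div_succ (Site.supNorm x) (show 0 < R by omega)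
  rw [h] at h1
  have h2 : R * (k + 1) = R * k + (R - 1) + 1 := by
    rw [Nat.mul_succ]; omega
  omega

omit [MeasurableSpace Circle] [BorelSpace Circle] in
/-- **Simon's lattice sum**: for `0 ≤ m < 1` and `R ≥ 1`, `∑_{x ∈ ℤ^ν} m^{⌊‖x‖_∞/R⌋}` converges (the `k`-th block has
at most `(2R(k+1))^ν` sites; polynomial times geometric). This is the lattice sum that turns a box-criterion decay
`⟨σ₀σ_x⟩ ≤ m^{⌊‖x‖_∞/R⌋}` into a finite susceptibility, in every dimension.
[cite: Simon1980CMP, Thm 1.3 (exponential decay summed over the lattice)] -/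
theorem summable_pow_supNorm_div {R : ℕ} (hR : 1 ≤ R) {m : ℝ} (hm0 : 0 ≤ m) (hm1 : m < 1) :
    Summable fun x : Site ν => m ^ (Site.supNorm x / R) := by
  classical
  -- a positive majorant base `m' = max m ½ ∈ [½, 1)`
  set m' : ℝ := max m (1 / 2) with hm'
  have hm'0 : 0 < m' := lt_max_of_lt_right (by norm_num)
  have hm'1 : m' < 1 := max_lt hm1 (by norm_num)
  have hmm' : m ≤ m' := le_max_left _ _
  -- the block coefficients `a k = (2R)^ν (k+1)^ν m'^k` are summable
  set a : ℕ → ℝ := fun k => (2 * R : ℝ) ^ ν * (((k : ℝ) + 1) ^ ν * m' ^ k) with ha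
  have hgeo : Summable fun k : ℕ => ((k : ℝ) + 1) ^ ν * m' ^ k := by
    have h1 : Summable fun k : ℕ => ((k : ℝ)) ^ ν * m' ^ k :=
      summable_pow_mul_geometric_of_norm_lt_one ν (by rw [Real.norm_eq_abs, abs_of_pos hm'0]; exact hm'1)
    have h2 : Summable fun k : ℕ => (((k + 1 : ℕ) : ℝ)) ^ ν * m' ^ (k + 1) := (summable_nat_add_iff 1).2 h1
    have h3 : Summable fun k : ℕ => m'⁻¹ * ((((k + 1 : ℕ) : ℝ)) ^ ν * m' ^ (k + 1)) := h2.mul_left _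
    refine h3.congr fun k => ?_
    rw [pow_succ, Nat.cast_succ]
    field_simp
  have ha_sum : Summable a := hgeo.mul_left _
  have ha0 : ∀ k, 0 ≤ a k := fun k => by positivity
  -- every finite partial sum is bounded by `∑ a`
  refine summable_of_sum_le (fun x => pow_nonneg hm0 _) (c := ∑' k, a k) fun F => ?_
  set kf : Site ν → ℕ := fun x => Site.supNorm x / R with hkf
  calc ∑ x ∈ F, m ^ (Site.supNorm x / R)
      ≤ ∑ x ∈ F, m' ^ kf x := Finset.sum_le_sum fun x _ => pow_le_pow_left₀ hm0 hmm' _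
    _ = ∑ k ∈ F.image kf, ((F.filter fun x => kf x = k).card : ℝ) * m' ^ k := by
        rw [Finset.sum_comp (fun k => m' ^ k) kf]
        refine Finset.sum_congr rfl fun k _ => ?_
        rw [nsmul_eq_mul]
    _ ≤ ∑ k ∈ F.image kf, a k := by
        refine Finset.sum_le_sum fun k _ => ?_
        have hcard : ((F.filter fun x => kf x = k).card : ℝ) ≤ (2 * R : ℝ) ^ ν * ((k : ℝ) + 1) ^ ν := by
          have h1 : (F.filter fun x => kf x = k).card ≤ (box ν (R * k + (R - 1))).card :=
            Finset.card_le_card fun x hx => mem_box_of_supNorm_div_eq hR (Finset.mem_filter.1 hx).2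
          rw [card_box] at h1
          have h2 : ((F.filter fun x => kf x = k).card : ℝ) ≤ ((2 * (R * k + (R - 1)) + 1 : ℕ) : ℝ) ^ ν := by
            exact_mod_cast h1
          refine h2.trans ?_
          rw [← mul_pow]
          apply pow_le_pow_left₀ (by positivity)
          have hR' : ((R - 1 : ℕ) : ℝ) = (R : ℝ) - 1 := by
            rw [Nat.cast_sub hR, Nat.cast_one]
          push_cast
          rw [hR']
          nlinarith
        calc ((F.filter fun x => kf x = k).card : ℝ) * m' ^ k
            ≤ (2 * R : ℝ) ^ ν * ((k : ℝ) + 1) ^ ν * m' ^ k :=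
              mul_le_mul_of_nonneg_right hcard (pow_nonneg hm'0.le _)
          _ = a k := by rw [ha]; ring
    _ ≤ ∑' k, a k := ha_sum.sum_le_tsum _ fun k _ => ha0 k

omit [MeasurableSpace Circle] [BorelSpace Circle] in
/-- A function on `ℤ^ν` dominated by a box-criterion decay `0 ≤ f(x) ≤ C·m^{⌊‖x‖_∞/R⌋}` (`0 ≤ m < 1`, `R ≥ 1`) is
summable. [cite: Simon1980CMP, Thm 1.3 (exponential decay summed over the lattice)] -/
theorem summable_of_le_pow_supNorm_div {R : ℕ} (hR : 1 ≤ R) {m C : ℝ} (hm0 : 0 ≤ m) (hm1 : m < 1)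
    {f : Site ν → ℝ} (hf0 : ∀ x, 0 ≤ f x) (hf : ∀ x, f x ≤ C * m ^ (Site.supNorm x / R)) : Summable f :=
  Summable.of_nonneg_of_le hf0 hf ((summable_pow_supNorm_div hR hm0 hm1).mul_left C)

end LatticeSum

/-! ## §5 The converse at weak coupling: one terminating 2D box keeps the stack's susceptibility finite -/

section Converse

/-- **Uniform decay of `G^{3D}` from ONE two-dimensional box.** If `S_R(K₀) < 1` (`R ≥ 1`, `K₀ ≥ 0`) then for all
`β, J∥, J⊥ ≥ 0` with `βJ∥ ≤ K₀` and `βJ⊥ ≤ (1 − S_R(K₀))/(2(χ^{int}_R(K₀) + 1))`, and all `x, y ∈ ℤ³`: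
`G^{3D}_{β; J∥, J⊥}(x, y) ≤ ((1 + S_R(K₀))/2)^{⌊‖x − y‖_∞/R⌋}` (`layered_decay_supNorm_of_nnBoxShellSum_lt_one` in every
box, then the supremum). [cite: Lieb1980, eq. (23) and p. 128 (boxes; finite algorithm); Simon1980CMP, Thm 1.3] -/
theorem infTwoPointLayered_le_pow_of_nnBoxShellSum_lt_one {K₀ : ℝ} (hK0 : 0 ≤ K₀) {R : ℕ} (hR : 1 ≤ R)
    (hS : nnBoxShellSum K₀ 2 R < 1) {β Jp Jz : ℝ} (hβ : 0 ≤ β) (hp : 0 ≤ Jp) (hz : 0 ≤ Jz) (hx : β * Jp ≤ K₀)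
    (hy : β * Jz ≤ (1 - nnBoxShellSum K₀ 2 R) / (2 * (boxInteriorSum K₀ R + 1))) (x y : Site 3) :
    infTwoPointLayered β Jp Jz x y ≤ ((1 + nnBoxShellSum K₀ 2 R) / 2) ^ (Site.supNorm (x - y) / R) := by
  have hS0 : 0 ≤ nnBoxShellSum K₀ 2 R :=
    boxShellSum_nonneg (fun u v => mul_nonneg (by positivity) (nnCoupling_nonneg _ _)) R
  refine infTwoPointLayered_le_of_forall_box fun n => ?_
  by_cases h : x ∈ box 3 n ∧ y ∈ box 3 n
  · rw [volTwoPointLayered_of_mem β Jp Jz h.1 h.2]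
    exact layered_decay_supNorm_of_nnBoxShellSum_lt_one hK0 hR hS hβ hp hz hx hy (box 3 n) ⟨x, h.1⟩ ⟨y, h.2⟩
  · unfold volTwoPointLayered
    rw [dif_neg h]
    exact pow_nonneg (by linarith) _

/-- **One terminating two-dimensional box keeps the stack's susceptibility finite at weak coupling.** If
`S_R(K₀) < 1` then for all `β, J∥, J⊥ ≥ 0` with `βJ∥ ≤ K₀` and `βJ⊥ ≤ (1 − S_R(K₀))/(2(χ^{int}_R(K₀) + 1))`:
`∑_{z ∈ ℤ³} G^{3D}_{β; J∥, J⊥}(0, z) < ∞`. [cite: Lieb1980, p. 128 (boxes; finite algorithm); Simon1980CMP, Thm 1.3; LiuStanley1972, p. 272 (layers (J, J, εJ))] -/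
theorem summable_layered_of_nnBoxShellSum_lt_one {K₀ : ℝ} (hK0 : 0 ≤ K₀) {R : ℕ} (hR : 1 ≤ R)
    (hS : nnBoxShellSum K₀ 2 R < 1) {β Jp Jz : ℝ} (hβ : 0 ≤ β) (hp : 0 ≤ Jp) (hz : 0 ≤ Jz) (hx : β * Jp ≤ K₀)
    (hy : β * Jz ≤ (1 - nnBoxShellSum K₀ 2 R) / (2 * (boxInteriorSum K₀ R + 1))) :
    Summable fun z : Site 3 => infTwoPointLayered β Jp Jz 0 z := by
  have hS0 : 0 ≤ nnBoxShellSum K₀ 2 R :=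
    boxShellSum_nonneg (fun u v => mul_nonneg (by positivity) (nnCoupling_nonneg _ _)) R
  refine summable_of_le_pow_supNorm_div (ν := 3) hR (m := (1 + nnBoxShellSum K₀ 2 R) / 2) (C := 1)
    (by linarith) (by linarith) (fun z => infTwoPointLayered_nonneg hβ hp hz 0 z) fun z => ?_
  have h := infTwoPointLayered_le_pow_of_nnBoxShellSum_lt_one hK0 hR hS hβ hp hz hx hy 0 z
  rwa [zero_sub, Site.supNorm_neg, ← one_mul (((1 + nnBoxShellSum K₀ 2 R) / 2) ^ _)] at h

/-- **The single layer's finite-susceptibility phase survives weak interlayer coupling.** If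
`∑_{x ∈ ℤ²} G^{2D}_{K₀}(0, x) < ∞` (`K₀ ≥ 0`) then there is `δ = δ(K₀) > 0` such that for all `β, J∥, J⊥ ≥ 0` with
`βJ∥ ≤ K₀` and `βJ⊥ ≤ δ`: `∑_{z ∈ ℤ³} G^{3D}_{β; J∥, J⊥}(0, z) < ∞` (Simon–Lieb for the layer gives a terminating box,
`exists_nnBoxShellSum_lt_one_of_summable`; then `summable_layered_of_nnBoxShellSum_lt_one`). With
`summable_layer_of_summable_layered` (the other inclusion, for every `J⊥`): the finite-susceptibility phase of the
stack converges to that of one layer as `J⊥ → 0` — `lim_{J⊥ → 0} T_χ^{3D}(J∥, J⊥) = T_χ^{2D}(J∥)`, and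
`T_χ^{3D}(J∥, J⊥) ≥ T_χ^{2D}(J∥)` throughout. [cite: Simon1980CMP, Thm 1.3; Lieb1980, p. 128 (boxes; finite algorithm); LiuStanley1972, p. 272 (T_c(ε) of the layers (J, J, εJ))] -/
theorem summable_layered_of_summable_layer {K₀ : ℝ} (hK0 : 0 ≤ K₀)
    (hG : Summable fun x : Site 2 => infTwoPoint K₀ 2 0 x) :
    ∃ δ : ℝ, 0 < δ ∧ ∀ ⦃β Jp Jz : ℝ⦄, 0 ≤ β → 0 ≤ Jp → 0 ≤ Jz → β * Jp ≤ K₀ → β * Jz ≤ δ →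
      Summable fun z : Site 3 => infTwoPointLayered β Jp Jz 0 z := by
  obtain ⟨R, hR, hS⟩ := exists_nnBoxShellSum_lt_one_of_summable hK0 hG
  have hX0 : 0 ≤ boxInteriorSum K₀ R := boxInteriorSum_nonneg hK0 R
  exact ⟨(1 - nnBoxShellSum K₀ 2 R) / (2 * (boxInteriorSum K₀ R + 1)), div_pos (by linarith) (by positivity),
    fun β Jp Jz hβ hp hz hx hy => summable_layered_of_nnBoxShellSum_lt_one hK0 hR hS hβ hp hz hx hy⟩

/-- **In the Aizenman–Simon–Onsager window the stack has finite susceptibility at weak coupling**: for every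
`0 ≤ K₀ < log(1+√2)` there is `δ > 0` with `∑_z G^{3D}_{β; J∥, J⊥}(0, z) < ∞` whenever `βJ∥ ≤ K₀`, `βJ⊥ ≤ δ`
(`β, J∥, J⊥ ≥ 0`). [cite: AizenmanSimon1980RotorIsing, eqs. (1)–(2); Lieb1980, p. 128; LiuStanley1972, p. 272] -/
theorem summable_layered_of_lt_log_one_add_sqrt_two {K₀ : ℝ} (hK0 : 0 ≤ K₀)
    (hK : K₀ < Real.log (1 + Real.sqrt 2)) :
    ∃ δ : ℝ, 0 < δ ∧ ∀ ⦃β Jp Jz : ℝ⦄, 0 ≤ β → 0 ≤ Jp → 0 ≤ Jz → β * Jp ≤ K₀ → β * Jz ≤ δ →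
      Summable fun z : Site 3 => infTwoPointLayered β Jp Jz 0 z :=
  summable_layered_of_summable_layer hK0 (summable_infTwoPoint_of_lt_log_one_add_sqrt_two hK0 hK)


/-- **The single layer's finite-susceptibility phase is a down-set in `K`** (Griffiths–Ginibre in the coupling):
`0 ≤ K ≤ K'` and `∑_x G_{K'}(0, x) < ∞` ⇒ `∑_x G_K(0, x) < ∞`. [cite: Ginibre1970, Prop. 3 with Example 4 (plane rotators)] -/
theorem summable_infTwoPoint_of_le {ν : ℕ} {K K' : ℝ} (hK : 0 ≤ K) (hKK' : K ≤ K')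
    (hG : Summable fun x : Site ν => infTwoPoint K' ν 0 x) : Summable fun x : Site ν => infTwoPoint K ν 0 x := by
  refine Summable.of_nonneg_of_le (fun x => infTwoPoint_nonneg hK 0 x) (fun x => ?_) hG
  refine infTwoPoint_le_of_forall_box fun n => (le_trans ?_ (volTwoPoint_box_le_infTwoPoint K' n 0 x))
  by_cases h : (0 : Site ν) ∈ box ν n ∧ x ∈ box ν n
  · rw [volTwoPoint_of_mem K h.1 h.2, volTwoPoint_of_mem K' h.1 h.2]
    refine twoPoint_mono (fun p => mul_nonneg (div_nonneg hK zero_le_two) (nnCoupling_nonneg _ _)) (fun p => ?_) _ _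
    unfold nnXYCoupling
    exact mul_le_mul_of_nonneg_right (by linarith) (nnCoupling_nonneg _ _)
  · unfold volTwoPoint
    rw [dif_neg h, dif_neg h]

/-- **Downward inheritance of the finite-susceptibility phase** (Griffiths–Ginibre): if the stack at couplings
`(1, K∥, K⊥)` has `∑_z G^{3D}(0, z) < ∞` then so does every stack with `βJ∥ ≤ K∥`, `βJ⊥ ≤ K⊥` (`β, J∥, J⊥ ≥ 0`).
[cite: Ginibre1970, Prop. 3 with Example 4 (plane rotators)] -/
theorem summable_layered_of_mul_le {β Jp Jz Kp Kz : ℝ} (hβ : 0 ≤ β) (hp : 0 ≤ Jp) (hz : 0 ≤ Jz)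
    (hKp : β * Jp ≤ Kp) (hKz : β * Jz ≤ Kz) (hG : Summable fun z : Site 3 => infTwoPointLayered 1 Kp Kz 0 z) :
    Summable fun z : Site 3 => infTwoPointLayered β Jp Jz 0 z :=
  Summable.of_nonneg_of_le (fun z => infTwoPointLayered_nonneg hβ hp hz 0 z)
    (fun z => infTwoPointLayered_mono_of_mul_le hβ hp hz hKp hKz 0 z) hG

/-- **The single layer's finite-susceptibility phase is exactly the weak-coupling limit of the stack's**: for
`K₀ ≥ 0`, `∑_x G^{2D}_{K₀}(0, x) < ∞` iff there is `δ > 0` such that every stack with `βJ∥ ≤ K₀`, `βJ⊥ ≤ δ` has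
`∑_z G^{3D}(0, z) < ∞` (⇒: `summable_layered_of_summable_layer`; ⇐: the stack at `(1, K₀, 0)` dominates the layer,
`summable_layer_of_summable_layered`). In temperature language: `T > T_χ^{2D}(J∥)` iff `T > T_χ^{3D}(J∥, J⊥)` for all
sufficiently small `J⊥` — `lim_{J⊥ → 0} T_χ^{3D}(J∥, J⊥) = T_χ^{2D}(J∥)` from above.
[cite: Simon1980CMP, Thm 1.3; Lieb1980, p. 128 (boxes); LiuStanley1972, p. 272 (T_c(ε) of the layers (J, J, εJ))] -/
theorem summable_layer_iff_summable_layered_weak {K₀ : ℝ} (hK0 : 0 ≤ K₀) :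
    (Summable fun x : Site 2 => infTwoPoint K₀ 2 0 x) ↔
      ∃ δ : ℝ, 0 < δ ∧ ∀ ⦃β Jp Jz : ℝ⦄, 0 ≤ β → 0 ≤ Jp → 0 ≤ Jz → β * Jp ≤ K₀ → β * Jz ≤ δ →
        Summable fun z : Site 3 => infTwoPointLayered β Jp Jz 0 z := by
  refine ⟨summable_layered_of_summable_layer hK0, fun ⟨δ, hδ, h⟩ => ?_⟩
  have h1 : Summable fun z : Site 3 => infTwoPointLayered 1 K₀ 0 0 z :=
    h zero_le_one hK0 le_rfl (by rw [one_mul]) (by rw [one_mul]; exact hδ.le)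
  have h2 := summable_layer_of_summable_layered zero_le_one hK0 le_rfl h1
  rwa [one_mul] at h2

end Converse

end PlaneRotator

end Literature.Probability.LatticeModels

end
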